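import Mathlib
import Summits.ValiantsHypothesis.ValiantsHypothesis.Theorems.NewtonUnitEquationsDissociatedUniformTotalsLawBinary
import HarnessLib

/-!
# Crux `NewtonUnitEquations.DissociatedUniform` (stmt-ValiantsHypothesis-5905): the general totals law holds with `C = 1` for every label group of order `≤ 2`

Companion of `…TotalsLawBinary` (the binary row `T(n, ℤ/2) ≤ 4n`).  The typed conjecture `TotalsLawN.TotalsLawGeneral C` quantifies
over ALL finite abelian label groups `G`; this file records the honest maximal extent of what the binary row proves:
`TotalsLawGeneral 1` holds for every `G` with `|G| ≤ 2` (`totalsLawGeneral_one_of_card_le_two`).  Ingredients: the classes (hence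
`T`) are invariant under relabelling the letters along a group isomorphism (`classPts_comp_addEquiv`, `totalVert_comp_addEquiv`),
a group of order `2` is `≃+ ZMod 2` (Mathlib: prime order ⇒ cyclic), and for `|G| = 1` every class is a single point.
The general law for `|G| ≥ 3`, the `n = 3` law and `stub_smallShadow` stay OPEN; VP ≠ VNP is not touched.
[folklore: extreme points of the hull of a finite set lie in the set]
-/

set_option linter.dupNamespace false -- `ValiantsHypothesis.ValiantsHypothesis` (summit = problem) in every name

open scoped BigOperators

namespace Summit.ValiantsHypothesis.ValiantsHypothesis.Theorems.NewtonUnitEquationsDissociatedUniform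

namespace TotalsLawN

variable {G H : Type*} [AddCommGroup G] [AddCommGroup H] {n : ℕ}

/-- Relabelling the letters along a group isomorphism `e : H ≃+ G` carries the class `s` to the class `e s`. [folklore] -/
theorem classPts_comp_addEquiv (e : H ≃+ G) (c : Fin n → G → (Fin 2 → ℝ)) (s : H) :
    classPts (fun j x => c j (e x)) s = classPts c (e s) := by
  ext p
  simp only [classPts, Set.mem_range, Subtype.exists]
  constructor
  · rintro ⟨x, hx, rfl⟩
    exact ⟨fun j => e (x j), by rw [← map_sum, hx], rfl⟩
  · rintro ⟨y, hy, rfl⟩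
    refine ⟨fun j => e.symm (y j), ?_, ?_⟩
    · rw [← map_sum, hy, e.symm_apply_apply]
    · exact Finset.sum_congr rfl fun j _ => by rw [e.apply_symm_apply]

/-- `T` is invariant under relabelling along a group isomorphism. [folklore] -/
theorem totalVert_comp_addEquiv [Fintype G] [Fintype H] (e : H ≃+ G) (c : Fin n → G → (Fin 2 → ℝ)) :
    totalVert (fun j x => c j (e x)) = totalVert c := by
  unfold totalVert classVert
  exact Fintype.sum_equiv e.toEquiv _ _ fun s => by rw [AddEquiv.toEquiv_eq_coe, AddEquiv.coe_toEquiv, classPts_comp_addEquiv]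

/-- Over a one-element label group every class is a single point: `V_s ≤ 1`. [folklore] -/
theorem classVert_le_one_of_subsingleton [Fintype G] [Subsingleton G] (c : Fin n → G → (Fin 2 → ℝ)) (s : G) :
    classVert c s ≤ 1 := by
  unfold classVert
  have hfin : (classPts c s).Finite := Set.finite_range _
  have hsub : (classPts c s).Subsingleton := Set.subsingleton_range _
  calc (Set.extremePoints ℝ (convexHull ℝ (classPts c s))).ncard
      ≤ (classPts c s).ncard := Set.ncard_le_ncard extremePoints_convexHull_subset hfin
    _ ≤ 1 := (Set.ncard_le_one hfin).2 fun a ha b hb => hsub ha hb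

/-- **`TotalsLawGeneral 1` holds for every label group of order at most `2`.**  For a finite abelian `G` with `|G| ≤ 2`, every `n`
and all curves `c : Fin n → G → ℝ²`: `totalVert c ≤ 1 * (n + 1) * |G|²` (the body of the typed conjecture `TotalsLawGeneral 1` at
this `G`; the conjecture itself — all finite abelian `G` — stays OPEN and is not asserted). -/
theorem totalsLawGeneral_one_of_card_le_two {G : Type} [AddCommGroup G] [Fintype G] (hG : Fintype.card G ≤ 2) (n : ℕ)
    (c : Fin n → G → (Fin 2 → ℝ)) : totalVert c ≤ 1 * (n + 1) * Fintype.card G ^ 2 := by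
  have hpos : 0 < Fintype.card G := Fintype.card_pos
  rcases Nat.lt_or_ge (Fintype.card G) 2 with h1 | h2
  · -- `|G| = 1`
    have hcard : Fintype.card G = 1 := by omega
    haveI : Subsingleton G := Fintype.card_le_one_iff_subsingleton.1 hcard.le
    unfold totalVert
    calc ∑ s, classVert c s ≤ ∑ _s : G, 1 := Finset.sum_le_sum fun s _ => classVert_le_one_of_subsingleton c s
      _ = Fintype.card G := by rw [Finset.sum_const, Finset.card_univ, smul_eq_mul, mul_one]
      _ ≤ 1 * (n + 1) * Fintype.card G ^ 2 := by rw [hcard]; omega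
  · -- `|G| = 2`: relabel along `ZMod 2 ≃+ G`
    have hcard : Fintype.card G = 2 := le_antisymm hG h2
    have hnat : Nat.card G = 2 := by rw [Nat.card_eq_fintype_card, hcard]
    have hcyc : IsAddCyclic G := isAddCyclic_of_prime_card (p := 2) hnat
    let e : ZMod 2 ≃+ G := ((ZMod.ringEquivCongr hnat).symm.toAddEquiv).trans (zmodAddCyclicAddEquiv hcyc)
    have h := totalsLawGeneral_one_zmod_two n fun j x => c j (e x)
    rw [ZMod.card] at h
    rw [← totalVert_comp_addEquiv e c, hcard]
    exact h

end TotalsLawN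

end Summit.ValiantsHypothesis.ValiantsHypothesis.Theorems.NewtonUnitEquationsDissociatedUniform
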